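import Literature.Probability.RandomPlanarGeometry.SLEKappaRhoLogGamma
import Mathlib.Analysis.SpecialFunctions.Pow.Complex
import HarnessLib

/-!
# [LSW] Lemma 8.9: the printed coefficients — closed forms of the first and second derivatives of `log M`

Sequel to `SLEKappaRhoLogGamma` (the holomorphic function
`ell E ρ x y = (5/8) log E'(x) + b log E'(y) + c log DQ E x y` of the two evaluation points and its
Cauchy-estimate expansion at `(0, y₀)`), after

* G. F. Lawler, O. Schramm, W. Werner, *Conformal restriction: the chordal case*, J. Amer. Math.
  Soc. **16** (2003) 917–955, arXiv:math/0209343 (**[LSW]**), §8.4, proof of Lemma 8.9: with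
  `L = (5/8) log h'(W) + b log h'(O) + c log(h(W) − h(O)) − c log(W − O)`, Itô's formula needs
  `∂_W L = (5/8) h''(W)/h'(W) + c (h'(W)/(h(W) − h(O)) − 1/(W − O))`,
  `∂_O L = b h''(O)/h'(O) + c (−h'(O)/(h(W) − h(O)) + 1/(W − O))` and `∂_W² L`.

In slid coordinates (`W ↦ x` at `0`, `O ↦ y` at `o < 0`, `h ↦ E` with `E(0) = 0`) these are the
derivatives of the slices of `ell` that appear as ABSTRACT coefficients in
`SLEKappaRho.norm_ell_sub_ell_sub_le`. This file computes them in closed form (honest `HasDerivAt`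
computations; the divided difference is the quotient `(E x − E o)/(x − o)` near `x = 0 ≠ o`):

* `hasDerivAt_ell_left`, `deriv_ell_left_eq` — `∂ₓell(0, o) = (5/8) E''(0)/E'(0) + c (1/o − E'(0)/E(o))`;
* `hasDerivAt_ell_right`, `deriv_ell_right_eq` — `∂_y ell(0, o) = b E''(o)/E'(o) + c (E'(o)/E(o) − 1/o)`;
* `iteratedDeriv_two_ell_left_eq` — `∂ₓ²ell(0, o) = (5/8)(E'''(0)/E'(0) − E''(0)²/E'(0)²) +
  c (Q''(0)/Q(0) − Q'(0)²/Q(0)²)` with `Q(x) = (E x − E o)/(x − o)`, `Q(0) = E(o)/o`,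
  `Q'(0) = (E(o) − o E'(0))/o²`, `Q''(0) = (2 Q'(0) − E''(0))/o`;
* realness on the axis (`im_deriv_eq_zero_of_real`, `ell_ofReal_im`) and the identification
  **`exp (ell E ρ 0 o) = E'(0)^{5/8} · E'(o)^b · (E(o)/o)^c`** (real powers) for real `o < 0` in the
  box (`exp_ell_zero_ofReal`) — with `E = E_B` this is `oneSidedM ρ B o`
  (`IsPlusHull.oneSidedM_eq_starMap`, `SLEKappaRhoTranslates`).

No named facts, no new definitions besides the abbreviation `sliceQ` for the quotient `Q`.

## References

* [LSW] §8.4, proof of Lemma 8.9. [LawlerSchrammWerner2003Restriction]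
-/

noncomputable section

open Set Filter Metric Complex
open scoped Topology Real

namespace Literature.Probability.RandomPlanarGeometry

namespace SLEKappaRho

variable {E : ℂ → ℂ} {δ η R : ℝ}

/-! ### Derivatives of `E` on the box -/

namespace JetControl

/-- `E` has derivative `E'(z)` at every point of the box. [folklore] -/
theorem hasDerivAt (hc : JetControl E δ η R) {z : ℂ} (hz : z ∈ jetBox R η) : HasDerivAt E (deriv E z) z :=
  (hc.differentiableOn.differentiableAt ((isOpen_jetBox R η).mem_nhds hz)).hasDerivAt

/-- `E'` has derivative `E''(z)` at every point of the box. [folklore] -/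
theorem hasDerivAt_deriv (hc : JetControl E δ η R) {z : ℂ} (hz : z ∈ jetBox R η) :
    HasDerivAt (deriv E) (deriv (deriv E) z) z :=
  (hc.differentiableOn_deriv.differentiableAt ((isOpen_jetBox R η).mem_nhds hz)).hasDerivAt

/-- `E''` is holomorphic on the box. [folklore] -/
theorem differentiableOn_deriv_deriv (hc : JetControl E δ η R) :
    DifferentiableOn ℂ (deriv (deriv E)) (jetBox R η) :=
  ((hc.differentiableOn_deriv.analyticOnNhd (isOpen_jetBox R η)).deriv).differentiableOn

/-- `E''` has derivative `E'''(z)` at every point of the box. [folklore] -/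
theorem hasDerivAt_deriv_deriv (hc : JetControl E δ η R) {z : ℂ} (hz : z ∈ jetBox R η) :
    HasDerivAt (deriv (deriv E)) (deriv (deriv (deriv E)) z) z :=
  (hc.differentiableOn_deriv_deriv.differentiableAt ((isOpen_jetBox R η).mem_nhds hz)).hasDerivAt

/-- `E'(z) ≠ 0` on the box. [folklore] -/
theorem deriv_ne_zero (hc : JetControl E δ η R) {z : ℂ} (hz : z ∈ jetBox R η) : deriv E z ≠ 0 :=
  fun h ↦ by have := hc.le_re_deriv z hz; rw [h] at this; simp at this; linarith [hc.δ_pos]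

/-- `E(z) ≠ 0` for `z ≠ 0` in the box (`E z = z · DQ E z 0` with `Re DQ ≥ δ > 0`). [folklore] -/
theorem map_ne_zero (hc : JetControl E δ η R) {z : ℂ} (hz : z ∈ jetBox R η) (hz0 : z ≠ 0) : E z ≠ 0 := by
  have h := DQ_mul_sub E z 0
  rw [hc.map_zero, sub_zero, sub_zero] at h
  have hDQ : DQ E z 0 ≠ 0 := fun h0 ↦ by
    have := (le_re_DQ_and_norm_DQ_le hc hz hc.zero_mem).1
    rw [h0] at this; simp at this; linarith [hc.δ_pos]
  rw [← h]
  exact mul_ne_zero hDQ hz0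

end JetControl

/-! ### The quotient `Q(x) = (E x − E o)/(x − o)` near `x = 0 ≠ o` -/

/-- The difference quotient `Q_o(x) = (E x − E o)/(x − o)` as an honest quotient (equal to
`DQ E x o` for `x ≠ o`). [folklore] -/
def sliceQ (E : ℂ → ℂ) (o x : ℂ) : ℂ := (E x - E o) / (x - o)

/-- `DQ E x o = sliceQ E o x` for `x ≠ o`. [folklore] -/
theorem DQ_eq_sliceQ (E : ℂ → ℂ) {x o : ℂ} (h : x ≠ o) : DQ E x o = sliceQ E o x := by
  rw [DQ_of_ne E h, sliceQ]

/-- Near `x₀ ≠ o`, `DQ E · o` agrees with the quotient. [folklore] -/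
theorem DQ_eventuallyEq_sliceQ (E : ℂ → ℂ) {x₀ o : ℂ} (h : x₀ ≠ o) :
    (fun x ↦ DQ E x o) =ᶠ[𝓝 x₀] sliceQ E o := by
  filter_upwards [isOpen_ne.mem_nhds h] with x hx using DQ_eq_sliceQ E hx

/-- **The derivative of the quotient**: `Q'(x₀) = (E'(x₀)(x₀ − o) − (E x₀ − E o))/(x₀ − o)²`.
[folklore] -/
theorem hasDerivAt_sliceQ (hc : JetControl E δ η R) {x₀ o : ℂ} (hx₀ : x₀ ∈ jetBox R η) (h : x₀ ≠ o) :
    HasDerivAt (sliceQ E o) ((deriv E x₀ * (x₀ - o) - (E x₀ - E o)) / (x₀ - o) ^ 2) x₀ := by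
  have hnum : HasDerivAt (fun x ↦ E x - E o) (deriv E x₀) x₀ := by
    simpa using (hc.hasDerivAt hx₀).sub_const (E o)
  have hden : HasDerivAt (fun x ↦ x - o) 1 x₀ := (hasDerivAt_id x₀).sub_const o
  have hq := hnum.div hden (sub_ne_zero.2 h)
  simp only [mul_one] at hq
  exact hq

/-- `DQ E · o` has the same derivative at `x₀ ≠ o`. [folklore] -/
theorem hasDerivAt_DQ_left (hc : JetControl E δ η R) {x₀ o : ℂ} (hx₀ : x₀ ∈ jetBox R η) (h : x₀ ≠ o) :
    HasDerivAt (fun x ↦ DQ E x o) ((deriv E x₀ * (x₀ - o) - (E x₀ - E o)) / (x₀ - o) ^ 2) x₀ :=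
  (hasDerivAt_sliceQ hc hx₀ h).congr_of_eventuallyEq (DQ_eventuallyEq_sliceQ E h)

/-! ### `∂ₓ ell(0, o)` and `∂_y ell(0, o)` in closed form -/

/-- **The `x`-derivative of `ell` at a point `x₀ ≠ o` of the box** (chain rule for the three
logarithms; the middle term is constant in `x`). [cite: LawlerSchrammWerner2003Restriction, proof of Lemma 8.9 (∂_W L)] -/
theorem hasDerivAt_ell_left (hc : JetControl E δ η R) (ρ : ℝ) {x₀ o : ℂ} (hx₀ : x₀ ∈ jetBox R η)
    (ho : o ∈ jetBox R η) (h : x₀ ≠ o) :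
    HasDerivAt (fun x ↦ ell E ρ x o)
      ((5 / 8 : ℂ) * (deriv (deriv E) x₀ / deriv E x₀) +
        (expC ρ : ℂ) * (((deriv E x₀ * (x₀ - o) - (E x₀ - E o)) / (x₀ - o) ^ 2) / DQ E x₀ o)) x₀ := by
  have h1 : HasDerivAt (fun x ↦ Complex.log (deriv E x)) (deriv (deriv E) x₀ / deriv E x₀) x₀ :=
    (hc.hasDerivAt_deriv hx₀).clog (hc.deriv_mem_slitPlane hx₀)
  have h3 : HasDerivAt (fun x ↦ Complex.log (DQ E x o))
      (((deriv E x₀ * (x₀ - o) - (E x₀ - E o)) / (x₀ - o) ^ 2) / DQ E x₀ o) x₀ :=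
    (hasDerivAt_DQ_left hc hx₀ h).clog (DQ_mem_slitPlane hc hx₀ ho)
  have h := ((h1.const_mul (5 / 8 : ℂ)).add (hasDerivAt_const x₀ ((expB ρ : ℂ) * Complex.log (deriv E o)))).add
    (h3.const_mul (expC ρ : ℂ))
  simp only [add_zero] at h
  exact h

/-- **`∂ₓ ell(0, o) = (5/8) E''(0)/E'(0) + c (1/o − E'(0)/E(o))`** for `o ≠ 0` in the box
([LSW]: `∂_W L = (5/8) h''(W)/h'(W) + c (h'(W)/(h(W) − h(O)) − 1/(W − O))` with `h(W) = E(0) = 0`,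
`h(O) = E(o)`, `W − O = −o`). [cite: LawlerSchrammWerner2003Restriction, proof of Lemma 8.9 (∂_W L)] -/
theorem deriv_ell_left_eq (hc : JetControl E δ η R) (ρ : ℝ) {o : ℂ} (ho : o ∈ jetBox R η) (ho0 : o ≠ 0) :
    deriv (fun x ↦ ell E ρ x o) 0 =
      (5 / 8 : ℂ) * (deriv (deriv E) 0 / deriv E 0) + (expC ρ : ℂ) * (1 / o - deriv E 0 / E o) := by
  have h := (hasDerivAt_ell_left hc ρ hc.zero_mem ho ho0.symm).deriv
  rw [h, hc.map_zero]
  have hEo : E o ≠ 0 := hc.map_ne_zero ho ho0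
  have hDQ : DQ E 0 o = E o / o := by
    rw [DQ_of_ne E ho0.symm, hc.map_zero]; field_simp; ring
  rw [hDQ]
  congr 1
  field_simp
  ring

/-- **The `y`-derivative of `ell(0, ·)` at `o ≠ 0` in the box.**
[cite: LawlerSchrammWerner2003Restriction, proof of Lemma 8.9 (∂_O L)] -/
theorem hasDerivAt_ell_right (hc : JetControl E δ η R) (ρ : ℝ) {o : ℂ} (ho : o ∈ jetBox R η) (ho0 : o ≠ 0) :
    HasDerivAt (fun y ↦ ell E ρ 0 y)
      ((expB ρ : ℂ) * (deriv (deriv E) o / deriv E o) +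
        (expC ρ : ℂ) * (((deriv E o * (o - 0) - (E o - E 0)) / (o - 0) ^ 2) / DQ E 0 o)) o := by
  have h2 : HasDerivAt (fun y ↦ Complex.log (deriv E y)) (deriv (deriv E) o / deriv E o) o :=
    (hc.hasDerivAt_deriv ho).clog (hc.deriv_mem_slitPlane ho)
  -- `y ↦ DQ E 0 y = DQ E y 0` is the quotient with base point `0`
  have hDQ : HasDerivAt (fun y ↦ DQ E 0 y) ((deriv E o * (o - 0) - (E o - E 0)) / (o - 0) ^ 2) o := by
    have := hasDerivAt_DQ_left hc ho ho0 (o := 0)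
    refine this.congr_of_eventuallyEq (Eventually.of_forall fun y ↦ DQ_comm E 0 y)
  have h3 : HasDerivAt (fun y ↦ Complex.log (DQ E 0 y))
      (((deriv E o * (o - 0) - (E o - E 0)) / (o - 0) ^ 2) / DQ E 0 o) o :=
    hDQ.clog (DQ_mem_slitPlane hc hc.zero_mem ho)
  have h := ((hasDerivAt_const o ((5 / 8 : ℂ) * Complex.log (deriv E 0))).add (h2.const_mul (expB ρ : ℂ))).add
    (h3.const_mul (expC ρ : ℂ))
  simp only [zero_add] at h
  exact h

/-- **`∂_y ell(0, o) = b E''(o)/E'(o) + c (E'(o)/E(o) − 1/o)`** for `o ≠ 0` in the box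
([LSW]: `∂_O L = b h''(O)/h'(O) + c (−h'(O)/(h(W) − h(O)) + 1/(W − O))`).
[cite: LawlerSchrammWerner2003Restriction, proof of Lemma 8.9 (∂_O L)] -/
theorem deriv_ell_right_eq (hc : JetControl E δ η R) (ρ : ℝ) {o : ℂ} (ho : o ∈ jetBox R η) (ho0 : o ≠ 0) :
    deriv (fun y ↦ ell E ρ 0 y) o =
      (expB ρ : ℂ) * (deriv (deriv E) o / deriv E o) + (expC ρ : ℂ) * (deriv E o / E o - 1 / o) := by
  have h := (hasDerivAt_ell_right hc ρ ho ho0).deriv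
  rw [h, hc.map_zero]
  have hEo : E o ≠ 0 := hc.map_ne_zero ho ho0
  have hDQ : DQ E 0 o = E o / o := by
    rw [DQ_of_ne E ho0.symm, hc.map_zero]; field_simp; ring
  rw [hDQ]
  congr 1
  field_simp
  ring

/-! ### `∂ₓ² ell(0, o)` in closed form -/

/-- `E x − E o ≠ 0` for `x ≠ o` in the box (`= (x − o) · DQ` with `Re DQ ≥ δ`). [folklore] -/
theorem map_sub_map_ne_zero (hc : JetControl E δ η R) {x o : ℂ} (hx : x ∈ jetBox R η) (ho : o ∈ jetBox R η)
    (h : x ≠ o) : E x - E o ≠ 0 := by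
  rw [← DQ_mul_sub E x o]
  refine mul_ne_zero (fun h0 ↦ ?_) (sub_ne_zero.2 h)
  have := (le_re_DQ_and_norm_DQ_le hc hx ho).1
  rw [h0] at this; simp at this; linarith [hc.δ_pos]

/-- The numerator `N(x) = E'(x)(x − o) − (E x − E o)` of `Q'` has derivative `E''(x)(x − o)`.
[folklore] -/
theorem hasDerivAt_sliceNum (hc : JetControl E δ η R) {x o : ℂ} (hx : x ∈ jetBox R η) :
    HasDerivAt (fun x ↦ deriv E x * (x - o) - (E x - E o)) (deriv (deriv E) x * (x - o)) x := by
  have h1 : HasDerivAt (fun x ↦ deriv E x * (x - o)) (deriv (deriv E) x * (x - o) + deriv E x * 1) x :=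
    (hc.hasDerivAt_deriv hx).mul ((hasDerivAt_id x).sub_const o)
  have h2 : HasDerivAt (fun x ↦ E x - E o) (deriv E x) x := by simpa using (hc.hasDerivAt hx).sub_const (E o)
  exact (h1.sub h2).congr_deriv (by ring)

/-- **The derivative of the `x`-slice near `0` as an explicit function** `g`:
`∂ₓell(x, o) = (5/8) E''(x)/E'(x) + c N(x)/((x − o)(E x − E o))` for `x ≠ o` in the box.
[cite: LawlerSchrammWerner2003Restriction, proof of Lemma 8.9 (∂_W L)] -/
theorem deriv_ell_left_eq_of_ne (hc : JetControl E δ η R) (ρ : ℝ) {x o : ℂ} (hx : x ∈ jetBox R η)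
    (ho : o ∈ jetBox R η) (h : x ≠ o) :
    deriv (fun x ↦ ell E ρ x o) x =
      (5 / 8 : ℂ) * (deriv (deriv E) x / deriv E x) +
        (expC ρ : ℂ) * ((deriv E x * (x - o) - (E x - E o)) / ((x - o) * (E x - E o))) := by
  rw [(hasDerivAt_ell_left hc ρ hx ho h).deriv, DQ_of_ne E h]
  have h1 : x - o ≠ 0 := sub_ne_zero.2 h
  have h2 : E x - E o ≠ 0 := map_sub_map_ne_zero hc hx ho h
  congr 1
  field_simp

/-- **`∂ₓ² ell(0, o)` in closed form** for `o ≠ 0` in the box: with `d = E'(0)`, `c₂ = E''(0)`,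
`c₃ = E'''(0)`, `N₀ = E(o) − o d` (`= N(0)`), `N₁ = −o c₂` (`= N'(0)`), `D₀ = o E(o)`
(`= (0 − o)(E 0 − E o)`), `D₁ = −(E(o) + o d)` (`= D'(0)`),
`∂ₓ²ell(0, o) = (5/8)(c₃ d − c₂²)/d² + c (N₁ D₀ − N₀ D₁)/D₀²` — the second `W`-derivative of
`L` entering the Itô correction `½ (8/3) ∂_W² L`. [cite: LawlerSchrammWerner2003Restriction, proof of Lemma 8.9 (Itô's formula for dM_t)] -/
theorem iteratedDeriv_two_ell_left_eq (hc : JetControl E δ η R) (ρ : ℝ) {o : ℂ} (ho : o ∈ jetBox R η)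
    (ho0 : o ≠ 0) :
    iteratedDeriv 2 (fun x ↦ ell E ρ x o) 0 =
      (5 / 8 : ℂ) * ((deriv (deriv (deriv E)) 0 * deriv E 0 - deriv (deriv E) 0 * deriv (deriv E) 0) /
          deriv E 0 ^ 2) +
        (expC ρ : ℂ) * (((-(o * deriv (deriv E) 0)) * (o * E o) - (E o - o * deriv E 0) * (-(E o + o * deriv E 0))) /
          (o * E o) ^ 2) := by
  -- the explicit derivative `g` of the slice near `0`
  set g : ℂ → ℂ := fun x ↦ (5 / 8 : ℂ) * (deriv (deriv E) x / deriv E x) +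
    (expC ρ : ℂ) * ((deriv E x * (x - o) - (E x - E o)) / ((x - o) * (E x - E o))) with hg
  have hS : IsOpen (jetBox R η ∩ {x : ℂ | x ≠ o}) := (isOpen_jetBox R η).inter isOpen_ne
  have h0S : (0 : ℂ) ∈ jetBox R η ∩ {x : ℂ | x ≠ o} := ⟨hc.zero_mem, ho0.symm⟩
  have hev : deriv (fun x ↦ ell E ρ x o) =ᶠ[𝓝 0] g :=
    Filter.eventuallyEq_of_mem (hS.mem_nhds h0S) fun x hx ↦ deriv_ell_left_eq_of_ne hc ρ hx.1 ho hx.2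
  rw [iteratedDeriv_succ, iteratedDeriv_one, hev.deriv_eq]
  -- differentiate `g` at `0`
  have hd0 : deriv E 0 ≠ 0 := hc.deriv_ne_zero hc.zero_mem
  have hEo : E o ≠ 0 := hc.map_ne_zero ho ho0
  have hD0 : (0 - o) * (E 0 - E o) ≠ 0 := by
    rw [hc.map_zero]; exact mul_ne_zero (by simpa using ho0) (by simpa using hEo)
  have t1 : HasDerivAt (fun x ↦ deriv (deriv E) x / deriv E x)
      ((deriv (deriv (deriv E)) 0 * deriv E 0 - deriv (deriv E) 0 * deriv (deriv E) 0) / deriv E 0 ^ 2) 0 :=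
    (hc.hasDerivAt_deriv_deriv hc.zero_mem).div (hc.hasDerivAt_deriv hc.zero_mem) hd0
  have hN := hasDerivAt_sliceNum hc (o := o) hc.zero_mem
  have hDen : HasDerivAt (fun x ↦ (x - o) * (E x - E o)) (1 * (E 0 - E o) + (0 - o) * deriv E 0) 0 := by
    have h1 : HasDerivAt (fun x ↦ x - o) 1 0 := (hasDerivAt_id (0 : ℂ)).sub_const o
    have h2 : HasDerivAt (fun x ↦ E x - E o) (deriv E 0) 0 := by simpa using (hc.hasDerivAt hc.zero_mem).sub_const (E o)
    exact h1.mul h2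
  have t2 := hN.div hDen hD0
  have hgd : HasDerivAt g ((5 / 8 : ℂ) * ((deriv (deriv (deriv E)) 0 * deriv E 0 -
      deriv (deriv E) 0 * deriv (deriv E) 0) / deriv E 0 ^ 2) + (expC ρ : ℂ) *
      ((deriv (deriv E) 0 * (0 - o) * ((0 - o) * (E 0 - E o)) -
        (deriv E 0 * (0 - o) - (E 0 - E o)) * (1 * (E 0 - E o) + (0 - o) * deriv E 0)) /
        ((0 - o) * (E 0 - E o)) ^ 2)) 0 := (t1.const_mul _).add (t2.const_mul _)
  rw [hgd.deriv, hc.map_zero]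
  congr 1
  ring

/-! ### Realness on the axis and `exp ell = M` -/

/-- If `f` is holomorphic on an open set `U` and real at the real points of `U`, then `f'` is real
at the real points of `U`. [folklore] -/
theorem im_deriv_eq_zero_of_real {f : ℂ → ℂ} {U : Set ℂ} (hU : IsOpen U) (hf : DifferentiableOn ℂ f U)
    (hreal : ∀ x : ℝ, (x : ℂ) ∈ U → (f x).im = 0) {x : ℝ} (hx : (x : ℂ) ∈ U) :
    (deriv f x).im = 0 := by
  have hfd : HasDerivAt f (deriv f x) x := (hf.differentiableAt (hU.mem_nhds hx)).hasDerivAt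
  have h1 : HasDerivAt (fun t : ℝ ↦ f t) (deriv f x) x := by simpa using hfd.comp_ofReal
  have hc : HasDerivAt (fun t : ℝ ↦ (f t).im) (deriv f x).im x :=
    Complex.imCLM.hasFDerivAt.comp_hasDerivAt x h1
  have hev : (fun t : ℝ ↦ (f t).im) =ᶠ[𝓝 x] fun _ ↦ (0 : ℝ) := by
    have : {t : ℝ | (t : ℂ) ∈ U} ∈ 𝓝 x := (hU.preimage Complex.continuous_ofReal).mem_nhds hx
    filter_upwards [this] with t ht using hreal t ht
  have h0 : HasDerivAt (fun t : ℝ ↦ (f t).im) 0 x := (hasDerivAt_const x (0 : ℝ)).congr_of_eventuallyEq hev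
  exact hc.unique h0

namespace JetControl

/-- `E'` is real on the real points of the box. [folklore] -/
theorem im_deriv_ofReal (hc : JetControl E δ η R) {x : ℝ} (hx : (x : ℂ) ∈ jetBox R η) : (deriv E x).im = 0 :=
  im_deriv_eq_zero_of_real (isOpen_jetBox R η) hc.differentiableOn hc.im_ofReal hx

/-- `E'(x) = Re E'(x)` (as complex numbers) and `0 < Re E'(x)` at real points of the box. [folklore] -/
theorem deriv_ofReal_eq (hc : JetControl E δ η R) {x : ℝ} (hx : (x : ℂ) ∈ jetBox R η) :
    deriv E x = ((deriv E x).re : ℂ) ∧ 0 < (deriv E x).re :=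
  ⟨Complex.ext (by simp) (by simp [hc.im_deriv_ofReal hx]), hc.δ_pos.trans_le (hc.le_re_deriv _ hx)⟩

/-- `E(x) = Re E(x)` at real points of the box. [folklore] -/
theorem map_ofReal_eq (hc : JetControl E δ η R) {x : ℝ} (hx : (x : ℂ) ∈ jetBox R η) :
    E x = ((E x).re : ℂ) :=
  Complex.ext (by simp) (by simp [hc.im_ofReal x hx])

end JetControl

/-- The logarithm of a positive real, as a complex number, times a real coefficient, exponentiates
to the real power: `exp (s · log p) = p ^ s`. [folklore] -/
theorem exp_mul_log_ofReal {p : ℝ} (hp : 0 < p) (s : ℝ) :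
    Complex.exp ((s : ℂ) * Complex.log (p : ℂ)) = ((p ^ s : ℝ) : ℂ) := by
  rw [Complex.ofReal_cpow hp.le, Complex.cpow_def_of_ne_zero (by exact_mod_cast hp.ne'), mul_comm]

/-- **`exp (ell E ρ 0 o) = E'(0)^{5/8} · E'(o)^b · (E(o)/o)^c`** (real powers of positive reals) for
a real `o < 0` in the box: the three logarithms are logarithms of the positive reals `E'(0)`,
`E'(o)` and `DQ E 0 o = E(o)/o`. With `E = E_B` the right-hand side is `oneSidedM ρ B o`
(`IsPlusHull.oneSidedM_eq_starMap`). [cite: LawlerSchrammWerner2003Restriction, §8.4 (definition of M_t)] -/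
theorem exp_ell_zero_ofReal (hc : JetControl E δ η R) (ρ : ℝ) {o : ℝ} (ho : (o : ℂ) ∈ jetBox R η) (ho0 : o < 0) :
    Complex.exp (ell E ρ 0 o) =
      (((deriv E 0).re ^ (5 / 8 : ℝ) * (deriv E o).re ^ expB ρ * ((E o).re / o) ^ expC ρ : ℝ) : ℂ) := by
  have h0 : ((0 : ℝ) : ℂ) ∈ jetBox R η := by simpa using hc.zero_mem
  obtain ⟨hd, hdpos⟩ := hc.deriv_ofReal_eq h0
  simp only [Complex.ofReal_zero] at hd hdpos
  obtain ⟨he, hepos⟩ := hc.deriv_ofReal_eq ho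
  have ho0' : (o : ℂ) ≠ 0 := by exact_mod_cast ho0.ne
  set d : ℝ := (deriv E 0).re with hd'
  set e : ℝ := (deriv E o).re with he'
  set q : ℝ := (E o).re / o with hq'
  -- the slope factor is the positive real `E(o)/o`
  have hDQ : DQ E 0 o = (q : ℂ) := by
    rw [DQ_of_ne E (Ne.symm ho0'), hc.map_zero, zero_sub, zero_sub, neg_div_neg_eq, hc.map_ofReal_eq ho, hq']
    push_cast; rfl
  have hqpos : 0 < q := by
    have h1 := (le_re_DQ_and_norm_DQ_le hc hc.zero_mem ho).1
    rw [hDQ, Complex.ofReal_re] at h1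
    exact hc.δ_pos.trans_le h1
  have h1 : Complex.log (deriv E 0) = Complex.log (d : ℂ) := congrArg Complex.log hd
  have h2 : Complex.log (deriv E o) = Complex.log (e : ℂ) := congrArg Complex.log he
  have h3 : Complex.log (DQ E 0 o) = Complex.log (q : ℂ) := congrArg Complex.log hDQ
  have h58 : (5 / 8 : ℂ) = ((5 / 8 : ℝ) : ℂ) := by push_cast; ring
  calc Complex.exp (ell E ρ 0 o)
      = Complex.exp (((5 / 8 : ℝ) : ℂ) * Complex.log (d : ℂ)) * Complex.exp ((expB ρ : ℂ) * Complex.log (e : ℂ)) *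
          Complex.exp ((expC ρ : ℂ) * Complex.log (q : ℂ)) := by
        rw [ell, h1, h2, h3, h58, Complex.exp_add, Complex.exp_add]
    _ = ((d ^ (5 / 8 : ℝ) : ℝ) : ℂ) * ((e ^ expB ρ : ℝ) : ℂ) * ((q ^ expC ρ : ℝ) : ℂ) := by
        rw [exp_mul_log_ofReal hdpos, exp_mul_log_ofReal hepos, exp_mul_log_ofReal hqpos]
    _ = _ := by push_cast; ring

/-! ### `P = O(Z)`: the combination `ρ ∂ₓell − 2 ∂_y ell` vanishes on the diagonal -/

section Phi

open Literature.Analysis.Complex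

/-- `F(y) = DQ E y 0 = E(y)/y` (`= d` at `0`): the slope factor seen as a function of `y`.
[folklore] -/
theorem DQ_zero_eq_div (hc : JetControl E δ η R) {y : ℂ} (hy0 : y ≠ 0) : DQ E y 0 = E y / y := by
  rw [DQ_of_ne E hy0, hc.map_zero, sub_zero, sub_zero]

/-- `E y = y · DQ E y 0` everywhere. [folklore] -/
theorem map_eq_mul_DQ (hc : JetControl E δ η R) (y : ℂ) : E y = y * DQ E y 0 := by
  have h := DQ_mul_sub E y 0
  rw [hc.map_zero, sub_zero, sub_zero] at h
  rw [← h, mul_comm]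

/-- `F = DQ E · 0` is holomorphic on the box. [folklore] -/
theorem differentiableOn_DQ_zero (hc : JetControl E δ η R) : DifferentiableOn ℂ (fun y ↦ DQ E y 0) (jetBox R η) :=
  differentiableOn_DQ_left hc hc.zero_mem

/-- **`F'(0) = E''(0)/2`**: differentiating `E(y) = y F(y)` twice at `0`. [folklore] -/
theorem deriv_DQ_zero_zero (hc : JetControl E δ η R) :
    deriv (fun y ↦ DQ E y 0) 0 = deriv (deriv E) 0 / 2 := by
  set F : ℂ → ℂ := fun y ↦ DQ E y 0 with hF
  have hFd : DifferentiableOn ℂ F (jetBox R η) := differentiableOn_DQ_zero hc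
  have hFa : AnalyticOnNhd ℂ F (jetBox R η) := hFd.analyticOnNhd (isOpen_jetBox R η)
  -- `E' = F + id · F'` on the box
  have hE' : ∀ y ∈ jetBox R η, deriv E y = F y + y * deriv F y := by
    intro y hy
    have hFy : HasDerivAt F (deriv F y) y := (hFd.differentiableAt ((isOpen_jetBox R η).mem_nhds hy)).hasDerivAt
    have h : HasDerivAt (fun y ↦ y * F y) (1 * F y + y * deriv F y) y := (hasDerivAt_id y).mul hFy
    have hEq : E = fun y ↦ y * F y := funext fun y ↦ map_eq_mul_DQ hc y
    rw [hEq, h.deriv, one_mul]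
  have hev : deriv E =ᶠ[𝓝 0] fun y ↦ F y + y * deriv F y :=
    Filter.eventuallyEq_of_mem ((isOpen_jetBox R η).mem_nhds hc.zero_mem) hE'
  have hF'0 : HasDerivAt F (deriv F 0) 0 := (hFd.differentiableAt ((isOpen_jetBox R η).mem_nhds hc.zero_mem)).hasDerivAt
  have hF''0 : HasDerivAt (deriv F) (deriv (deriv F) 0) 0 :=
    ((hFa.deriv.differentiableOn).differentiableAt ((isOpen_jetBox R η).mem_nhds hc.zero_mem)).hasDerivAt
  have h2 : HasDerivAt (fun y ↦ F y + y * deriv F y) (deriv F 0 + (1 * deriv F 0 + 0 * deriv (deriv F) 0)) 0 :=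
    hF'0.add ((hasDerivAt_id (0 : ℂ)).mul hF''0)
  rw [hev.deriv_eq, h2.deriv]
  ring

/-- `F(0) = E'(0)`. [folklore] -/
theorem DQ_zero_zero (E : ℂ → ℂ) : DQ E 0 0 = deriv E 0 := DQ_same E 0

/-- **The function `φ(y) = ρ ∂ₓell(0, y) − 2 ∂_y ell(0, y)` in a form holomorphic across `y = 0`**:
with `F = DQ E · 0` and `F₁ = dslope F 0`,
`phiFun E ρ y = ρ ((5/8) E''(0)/E'(0) + c F₁(y)/F(y)) − 2 (b E''(y)/E'(y) + c F'(y)/F(y))`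
(`P_t = M_t φ(O_t − W_t)` collects the terms of the drift of `M` driven by `ρ dt/(W − O)` and
`dO = −2 dt/(W − O)`). [cite: LawlerSchrammWerner2003Restriction, proof of Lemma 8.9 (the terms ρ h'(W)/(W − O), ρ h''(W)/(W − O) and dO)] -/
def phiFun (E : ℂ → ℂ) (ρ : ℝ) (y : ℂ) : ℂ :=
  (ρ : ℂ) * ((5 / 8 : ℂ) * (deriv (deriv E) 0 / deriv E 0) +
      (expC ρ : ℂ) * (dslope (fun y ↦ DQ E y 0) 0 y / DQ E y 0)) -
    2 * ((expB ρ : ℂ) * (deriv (deriv E) y / deriv E y) + (expC ρ : ℂ) * (deriv (fun y ↦ DQ E y 0) y / DQ E y 0))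

/-- **`φ(y) = ρ ∂ₓell(0, y) − 2 ∂_y ell(0, y)` for `y ≠ 0`** in the box (the closed forms
`deriv_ell_left_eq`, `deriv_ell_right_eq` rewritten through `F(y) = E(y)/y`).
[cite: LawlerSchrammWerner2003Restriction, proof of Lemma 8.9 (∂_W L, ∂_O L)] -/
theorem phiFun_eq_of_ne (hc : JetControl E δ η R) (ρ : ℝ) {y : ℂ} (hy : y ∈ jetBox R η) (hy0 : y ≠ 0) :
    phiFun E ρ y = (ρ : ℂ) * deriv (fun x ↦ ell E ρ x y) 0 - 2 * deriv (fun y' ↦ ell E ρ 0 y') y := by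
  rw [deriv_ell_left_eq hc ρ hy hy0, deriv_ell_right_eq hc ρ hy hy0, phiFun]
  have hEy : E y ≠ 0 := hc.map_ne_zero hy hy0
  have hd : deriv E 0 ≠ 0 := hc.deriv_ne_zero hc.zero_mem
  have hF : DQ E y 0 = E y / y := DQ_zero_eq_div hc hy0
  have hF1 : dslope (fun y ↦ DQ E y 0) 0 y = (E y / y - deriv E 0) / y := by
    rw [dslope_of_ne _ hy0, slope_def_field, DQ_zero_eq_div hc hy0, DQ_zero_zero, sub_zero]
  have hF' : deriv (fun y ↦ DQ E y 0) y = (deriv E y * y - E y) / y ^ 2 := by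
    have hev : (fun y ↦ DQ E y 0) =ᶠ[𝓝 y] fun y ↦ E y / y :=
      Filter.eventuallyEq_of_mem (isOpen_ne.mem_nhds hy0) fun y' hy' ↦ DQ_zero_eq_div hc hy'
    rw [hev.deriv_eq]
    have h := (hc.hasDerivAt hy).div (hasDerivAt_id y) hy0
    simp only [id, mul_one] at h
    exact h.deriv
  rw [hF, hF1, hF']
  field_simp

/-- **`φ(0) = 0`**: the poles of `(ρ ∂_W − 2 ∂_O) L` at `W = O` cancel for `b = ρ(4 + 3ρ)/32`,
`c = 3ρ/8` (`F(0) = E'(0)`, `F₁(0) = F'(0) = E''(0)/2`, so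
`φ(0) = (E''(0)/E'(0)) (5ρ/8 + ρc/2 − 2b − c) = 0`).
[cite: LawlerSchrammWerner2003Restriction, §8.4 ("when W_t = O_t we take M_t = h_t'(W_t)^{5/8+b+c}") with the proof of Lemma 8.9] -/
theorem phiFun_zero (hc : JetControl E δ η R) (ρ : ℝ) : phiFun E ρ 0 = 0 := by
  rw [phiFun, dslope_same, deriv_DQ_zero_zero hc, DQ_zero_zero]
  have hd : deriv E 0 ≠ 0 := hc.deriv_ne_zero hc.zero_mem
  simp only [expB, expC]
  push_cast
  field_simp
  ring

/-- `φ` is holomorphic on the box. [folklore] -/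
theorem differentiableOn_phiFun (hc : JetControl E δ η R) (ρ : ℝ) : DifferentiableOn ℂ (phiFun E ρ) (jetBox R η) := by
  have hF := differentiableOn_DQ_zero hc
  have hFne : ∀ y ∈ jetBox R η, DQ E y 0 ≠ 0 := fun y hy h0 ↦ by
    have := (le_re_DQ_and_norm_DQ_le hc hy hc.zero_mem).1
    rw [h0] at this; simp at this; linarith [hc.δ_pos]
  have hF1 : DifferentiableOn ℂ (dslope (fun y ↦ DQ E y 0) 0) (jetBox R η) :=
    (Complex.differentiableOn_dslope ((isOpen_jetBox R η).mem_nhds hc.zero_mem)).2 hF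
  have hF' : DifferentiableOn ℂ (deriv (fun y ↦ DQ E y 0)) (jetBox R η) :=
    ((hF.analyticOnNhd (isOpen_jetBox R η)).deriv).differentiableOn
  have hE'' := hc.differentiableOn_deriv_deriv
  have hE' := hc.differentiableOn_deriv
  have hE'ne : ∀ y ∈ jetBox R η, deriv E y ≠ 0 := fun y hy ↦ hc.deriv_ne_zero hy
  unfold phiFun
  refine (((differentiableOn_const _).add ((hF1.div hF hFne).const_mul _)).const_mul _).sub
    ((((hE''.div hE' hE'ne).const_mul _).add ((hF'.div hF hFne).const_mul _)).const_mul _)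

/-- The constant bounding `|φ|` on `ball 0 (η/2)`. [folklore] -/
def phiBound (ρ δ η : ℝ) : ℝ :=
  |ρ| * (5 / 8 * (4 / η) / δ + |expC ρ| * (8 / η) / δ) + 2 * (|expB ρ| * (8 / η) / δ + |expC ρ| * (8 / η) / δ)

/-- `0 ≤ phiBound`. [folklore] -/
theorem phiBound_nonneg (ρ : ℝ) {δ η : ℝ} (hδ : 0 < δ) (hη : 0 < η) : 0 ≤ phiBound ρ δ η := by
  unfold phiBound; positivity

/-- `|E''(y)| ≤ 8/η` for `y ∈ ball 0 (η/2)` (Cauchy on `ball y (η/2) ⊆ ball 0 η ⊆ box`). [folklore] -/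
theorem norm_deriv_deriv_le (hc : JetControl E δ η R) {y : ℂ} (hy : y ∈ ball (0 : ℂ) (η / 2)) :
    ‖deriv (deriv E) y‖ ≤ 8 / η := by
  have hsub : ball y (η / 2) ⊆ jetBox R η := by
    intro u hu
    refine ball_zero_subset_jetBox hc.R_nonneg hc.η_pos hc.η_le_one ?_
    rw [mem_ball, dist_zero_right] at hy ⊢
    rw [mem_ball] at hu
    calc ‖u‖ = dist u 0 := (dist_zero_right u).symm
      _ ≤ dist u y + dist y 0 := dist_triangle _ _ _
      _ < η / 2 + η / 2 := add_lt_add hu (by rwa [dist_zero_right])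
      _ = η := by ring
  have h := norm_deriv_le_of_forall_mem_ball (f := deriv E) (c := y) (by linarith [hc.η_pos] : 0 < η / 2)
    (hc.differentiableOn_deriv.mono hsub) fun u hu ↦ hc.norm_deriv_le u (hsub hu)
  refine h.trans (le_of_eq ?_); field_simp; ring

/-- `|F'(y)| ≤ 8/η` for `y ∈ ball 0 (η/2)` and `|F₁| ≤ 8/η` there (`F = DQ E · 0`, `|F| ≤ 2`).
[folklore] -/
theorem norm_deriv_DQ_zero_le (hc : JetControl E δ η R) {y : ℂ} (hy : y ∈ ball (0 : ℂ) (η / 2)) :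
    ‖deriv (fun y ↦ DQ E y 0) y‖ ≤ 8 / η ∧ ‖dslope (fun y ↦ DQ E y 0) 0 y‖ ≤ 8 / η := by
  set F : ℂ → ℂ := fun y ↦ DQ E y 0 with hF
  have hB := ball_zero_subset_jetBox hc.R_nonneg hc.η_pos hc.η_le_one (R := R)
  have hFd : DifferentiableOn ℂ F (ball (0 : ℂ) η) := (differentiableOn_DQ_zero hc).mono hB
  have hFM : ∀ u ∈ ball (0 : ℂ) η, ‖F u‖ ≤ 2 := fun u hu ↦ (le_re_DQ_and_norm_DQ_le hc (hB hu) hc.zero_mem).2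
  -- derivative bound on `ball 0 (η/2)` via balls of radius `η/2`
  have hder : ∀ u ∈ ball (0 : ℂ) (η / 2), ‖deriv F u‖ ≤ 8 / η := by
    intro u hu
    have hsub : ball u (η / 2) ⊆ ball (0 : ℂ) η := by
      intro v hv
      rw [mem_ball] at hu hv ⊢
      linarith [dist_triangle v u 0]
    have h := norm_deriv_le_of_forall_mem_ball (f := F) (c := u) (by linarith [hc.η_pos] : 0 < η / 2)
      (hFd.mono hsub) fun v hv ↦ hFM v (hsub hv)
    refine h.trans (le_of_eq ?_); field_simp; ring
  refine ⟨hder y hy, ?_⟩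
  rcases eq_or_ne y 0 with rfl | hy0
  · rw [dslope_same]; exact hder 0 hy
  · rw [dslope_of_ne _ hy0, slope_def_field, sub_zero, norm_div]
    have hmvt : ‖F y - F 0‖ ≤ 8 / η * ‖y - 0‖ :=
      (convex_ball (0 : ℂ) (η / 2)).norm_image_sub_le_of_norm_deriv_le
        (fun u hu ↦ hFd.differentiableAt (isOpen_ball.mem_nhds (ball_subset_ball (by linarith [hc.η_pos]) hu)))
        hder (mem_ball_self (by linarith [hc.η_pos])) hy
    rw [sub_zero] at hmvt
    rw [div_le_iff₀ (norm_pos_iff.2 hy0)]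
    exact hmvt

/-- **`|φ| ≤ phiBound` on `ball 0 (η/2)`.** [folklore] -/
theorem norm_phiFun_le (hc : JetControl E δ η R) (ρ : ℝ) {y : ℂ} (hy : y ∈ ball (0 : ℂ) (η / 2)) :
    ‖phiFun E ρ y‖ ≤ phiBound ρ δ η := by
  have hη := hc.η_pos
  have hδ := hc.δ_pos
  have hyB : y ∈ jetBox R η := ball_zero_subset_jetBox hc.R_nonneg hη hc.η_le_one (ball_subset_ball (by linarith) hy)
  have h0B : (0 : ℂ) ∈ ball (0 : ℂ) (η / 2) := mem_ball_self (by linarith)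
  -- the individual bounds
  have hc2 : ‖deriv (deriv E) 0‖ ≤ 4 / η := by
    have h := norm_deriv_le_of_forall_mem_ball (f := deriv E) (c := 0) hη
      (hc.differentiableOn_deriv.mono (ball_zero_subset_jetBox hc.R_nonneg hη hc.η_le_one))
      fun u hu ↦ hc.norm_deriv_le u (ball_zero_subset_jetBox hc.R_nonneg hη hc.η_le_one hu)
    refine h.trans (le_of_eq ?_); ring
  have hd : δ ≤ ‖deriv E 0‖ := (hc.le_re_deriv 0 hc.zero_mem).trans (re_le_norm _)
  have hEy : δ ≤ ‖deriv E y‖ := (hc.le_re_deriv y hyB).trans (re_le_norm _)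
  have hFy : δ ≤ ‖DQ E y 0‖ := (le_re_DQ_and_norm_DQ_le hc hyB hc.zero_mem).1.trans (re_le_norm _)
  have hE'' := norm_deriv_deriv_le hc hy
  obtain ⟨hF', hF1⟩ := norm_deriv_DQ_zero_le hc hy
  have hdpos : 0 < ‖deriv E 0‖ := hδ.trans_le hd
  have hEypos : 0 < ‖deriv E y‖ := hδ.trans_le hEy
  have hFypos : 0 < ‖DQ E y 0‖ := hδ.trans_le hFy
  -- quotients
  have q1 : ‖deriv (deriv E) 0 / deriv E 0‖ ≤ 4 / η / δ := by
    rw [norm_div]; exact div_le_div₀ (by positivity) hc2 hδ hd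
  have q2 : ‖dslope (fun y ↦ DQ E y 0) 0 y / DQ E y 0‖ ≤ 8 / η / δ := by
    rw [norm_div]; exact div_le_div₀ (by positivity) hF1 hδ hFy
  have q3 : ‖deriv (deriv E) y / deriv E y‖ ≤ 8 / η / δ := by
    rw [norm_div]; exact div_le_div₀ (by positivity) hE'' hδ hEy
  have q4 : ‖deriv (fun y ↦ DQ E y 0) y / DQ E y 0‖ ≤ 8 / η / δ := by
    rw [norm_div]; exact div_le_div₀ (by positivity) hF' hδ hFy
  have n58 : ‖(5 / 8 : ℂ)‖ = 5 / 8 := by norm_num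
  have nb : ‖(expB ρ : ℂ)‖ = |expB ρ| := by rw [Complex.norm_real, Real.norm_eq_abs]
  have ncc : ‖(expC ρ : ℂ)‖ = |expC ρ| := by rw [Complex.norm_real, Real.norm_eq_abs]
  have nρ : ‖(ρ : ℂ)‖ = |ρ| := by rw [Complex.norm_real, Real.norm_eq_abs]
  have n2 : ‖(2 : ℂ)‖ = 2 := by norm_num
  unfold phiFun phiBound
  calc _ ≤ ‖(ρ : ℂ) * ((5 / 8 : ℂ) * (deriv (deriv E) 0 / deriv E 0) +
          (expC ρ : ℂ) * (dslope (fun y ↦ DQ E y 0) 0 y / DQ E y 0))‖ +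
        ‖2 * ((expB ρ : ℂ) * (deriv (deriv E) y / deriv E y) +
          (expC ρ : ℂ) * (deriv (fun y ↦ DQ E y 0) y / DQ E y 0))‖ := norm_sub_le _ _
    _ ≤ |ρ| * (5 / 8 * (4 / η / δ) + |expC ρ| * (8 / η / δ)) + 2 * (|expB ρ| * (8 / η / δ) + |expC ρ| * (8 / η / δ)) := by
        gcongr
        · rw [norm_mul, nρ]
          gcongr
          refine (norm_add_le _ _).trans (add_le_add ?_ ?_)
          · rw [norm_mul, n58]; gcongr
          · rw [norm_mul, ncc]; gcongr
        · rw [norm_mul, n2]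
          gcongr
          refine (norm_add_le _ _).trans (add_le_add ?_ ?_)
          · rw [norm_mul, nb]; gcongr
          · rw [norm_mul, ncc]; gcongr
    _ = _ := by ring

/-- **`|φ(y)| ≤ (8 phiBound/η) |y|` for `|y| ≤ η/8`** (`φ(0) = 0` and the Cauchy–Lipschitz bound
on `ball 0 (η/2)`). [cite: LawlerSchrammWerner2003Restriction, proof of Lemma 8.9 with §8.4 (the diagonal W_t = O_t)] -/
theorem norm_phiFun_le_mul (hc : JetControl E δ η R) (ρ : ℝ) {y : ℂ} (hy : ‖y‖ ≤ η / 8) :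
    ‖phiFun E ρ y‖ ≤ 8 * phiBound ρ δ η / η * ‖y‖ := by
  have hη := hc.η_pos
  have hsub : ball (0 : ℂ) (η / 2) ⊆ jetBox R η := fun u hu ↦
    ball_zero_subset_jetBox hc.R_nonneg hη hc.η_le_one (ball_subset_ball (by linarith) hu)
  have h := norm_sub_le_of_forall_mem_ball (f := phiFun E ρ) (c := 0) (R := η / 2) (M := phiBound ρ δ η)
    (by linarith) ((differentiableOn_phiFun hc ρ).mono hsub) (fun u hu ↦ norm_phiFun_le hc ρ hu)
    (z := y) (by rw [sub_zero]; linarith)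
  rw [phiFun_zero hc ρ, sub_zero, sub_zero] at h
  refine h.trans (le_of_eq ?_)
  field_simp
  ring

/-- The crude bound for `|ρ ∂ₓell(0,o) − 2 ∂_y ell(0,o)|` at real `o` away from `0`. [folklore] -/
def phiFarBound (ρ δ η : ℝ) : ℝ :=
  |ρ| * (5 / 8 * (4 / η / δ) + |expC ρ| * (8 / η + 16 / (η * δ))) +
    2 * (|expB ρ| * (4 / η / δ) + |expC ρ| * (16 / (η * δ) + 8 / η))

/-- **Away from the diagonal** (`o` real, `−R−2 ≤ o ≤ −η/8`): `|ρ ∂ₓell(0,o) − 2 ∂_y ell(0,o)| ≤ phiFarBound`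
from the closed forms and `|1/o| ≤ 8/η`, `|E(o)| ≥ |o| δ`. [folklore] -/
theorem norm_rho_deriv_sub_le_far (hc : JetControl E δ η R) (ρ : ℝ) {o : ℝ} (ho : o ∈ Icc (-R - 2) 0)
    (hfar : o ≤ -(η / 8)) :
    ‖(ρ : ℂ) * deriv (fun x ↦ ell E ρ x o) 0 - 2 * deriv (fun y ↦ ell E ρ 0 y) o‖ ≤ phiFarBound ρ δ η := by
  have hη := hc.η_pos
  have hδ := hc.δ_pos
  have ho0 : o < 0 := by linarith
  have ho0' : (o : ℂ) ≠ 0 := by exact_mod_cast ho0.ne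
  have hoB : (o : ℂ) ∈ jetBox R η := ofReal_mem_jetBox hc ⟨ho.1, ho.2.trans hη.le⟩
  rw [deriv_ell_left_eq hc ρ hoB ho0', deriv_ell_right_eq hc ρ hoB ho0']
  -- the elementary bounds
  have habs : η / 8 ≤ |o| := by rw [abs_of_neg ho0]; linarith
  have habspos : 0 < |o| := abs_pos.2 ho0.ne
  have hinv : ‖(1 : ℂ) / o‖ ≤ 8 / η := by
    rw [norm_div, norm_one, Complex.norm_real, Real.norm_eq_abs, div_le_div_iff₀ habspos hη]
    linarith
  have hc2 : ‖deriv (deriv E) 0‖ ≤ 4 / η := by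
    have h := norm_deriv_le_of_forall_mem_ball (f := deriv E) (c := 0) hη
      (hc.differentiableOn_deriv.mono (ball_zero_subset_jetBox hc.R_nonneg hη hc.η_le_one))
      fun u hu ↦ hc.norm_deriv_le u (ball_zero_subset_jetBox hc.R_nonneg hη hc.η_le_one hu)
    refine h.trans (le_of_eq ?_); ring
  have hE''o : ‖deriv (deriv E) o‖ ≤ 4 / η := by
    have hsub := ball_subset_jetBox hc.η_le_one (R := R) (y₀ := o) ⟨ho.1, ho.2.trans hη.le⟩
    have h := norm_deriv_le_of_forall_mem_ball (f := deriv E) (c := (o : ℂ)) hη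
      (hc.differentiableOn_deriv.mono hsub) fun u hu ↦ hc.norm_deriv_le u (hsub hu)
    refine h.trans (le_of_eq ?_); ring
  have hd : δ ≤ ‖deriv E 0‖ := (hc.le_re_deriv 0 hc.zero_mem).trans (re_le_norm _)
  have hd2 : ‖deriv E 0‖ ≤ 2 := hc.norm_deriv_le 0 hc.zero_mem
  have hEo' : δ ≤ ‖deriv E o‖ := (hc.le_re_deriv _ hoB).trans (re_le_norm _)
  have hEo'2 : ‖deriv E o‖ ≤ 2 := hc.norm_deriv_le _ hoB
  have hEo : |o| * δ ≤ ‖E o‖ := by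
    rw [map_eq_mul_DQ hc (o : ℂ), norm_mul, Complex.norm_real, Real.norm_eq_abs]
    exact mul_le_mul_of_nonneg_left ((le_re_DQ_and_norm_DQ_le hc hoB hc.zero_mem).1.trans (re_le_norm _))
      (abs_nonneg _)
  have hEopos : 0 < ‖E o‖ := lt_of_lt_of_le (mul_pos habspos hδ) hEo
  have hoδ : η * δ / 8 ≤ ‖E o‖ := by
    calc η * δ / 8 = η / 8 * δ := by ring
      _ ≤ |o| * δ := by gcongr
      _ ≤ ‖E o‖ := hEo
  have q1 : ‖deriv (deriv E) 0 / deriv E 0‖ ≤ 4 / η / δ := by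
    rw [norm_div]; exact div_le_div₀ (by positivity) hc2 hδ hd
  have q2 : ‖deriv E 0 / E o‖ ≤ 16 / (η * δ) := by
    rw [norm_div, div_le_div_iff₀ hEopos (by positivity)]
    nlinarith
  have q3 : ‖deriv (deriv E) o / deriv E o‖ ≤ 4 / η / δ := by
    rw [norm_div]; exact div_le_div₀ (by positivity) hE''o hδ hEo'
  have q4 : ‖deriv E o / E o‖ ≤ 16 / (η * δ) := by
    rw [norm_div, div_le_div_iff₀ hEopos (by positivity)]
    nlinarith
  have n58 : ‖(5 / 8 : ℂ)‖ = 5 / 8 := by norm_num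
  have nb : ‖(expB ρ : ℂ)‖ = |expB ρ| := by rw [Complex.norm_real, Real.norm_eq_abs]
  have ncc : ‖(expC ρ : ℂ)‖ = |expC ρ| := by rw [Complex.norm_real, Real.norm_eq_abs]
  have nρ : ‖(ρ : ℂ)‖ = |ρ| := by rw [Complex.norm_real, Real.norm_eq_abs]
  have n2 : ‖(2 : ℂ)‖ = 2 := by norm_num
  unfold phiFarBound
  calc _ ≤ ‖(ρ : ℂ) * ((5 / 8 : ℂ) * (deriv (deriv E) 0 / deriv E 0) + (expC ρ : ℂ) * (1 / o - deriv E 0 / E o))‖ +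
        ‖2 * ((expB ρ : ℂ) * (deriv (deriv E) o / deriv E o) + (expC ρ : ℂ) * (deriv E o / E o - 1 / o))‖ :=
          norm_sub_le _ _
    _ ≤ |ρ| * (5 / 8 * (4 / η / δ) + |expC ρ| * (8 / η + 16 / (η * δ))) +
        2 * (|expB ρ| * (4 / η / δ) + |expC ρ| * (16 / (η * δ) + 8 / η)) := by
          gcongr
          · rw [norm_mul, nρ]
            gcongr
            refine (norm_add_le _ _).trans (add_le_add ?_ ?_)
            · rw [norm_mul, n58]; gcongr
            · rw [norm_mul, ncc]; gcongr; exact (norm_sub_le _ _).trans (add_le_add hinv q2)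
          · rw [norm_mul, n2]
            gcongr
            refine (norm_add_le _ _).trans (add_le_add ?_ ?_)
            · rw [norm_mul, nb]; gcongr
            · rw [norm_mul, ncc]; gcongr; exact (norm_sub_le _ _).trans (add_le_add q4 hinv)

/-- The constant of `P = O(Z)`. [folklore] -/
def phiConst (ρ δ η : ℝ) : ℝ := 8 * (phiBound ρ δ η + phiFarBound ρ δ η) / η

/-- **`P = O(Z)` uniformly up to the diagonal**: for every real `o ∈ [−R−2, 0)`,
`|ρ ∂ₓell(0, o) − 2 ∂_y ell(0, o)| ≤ phiConst · |o|`. Consequently the part of the one-step drift of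
`M` driven by the finite-variation terms `ρ ∫ ds/Z` and `O = −2 ∫ ds/Z` is `M · O(Z) · J`, which
stays summable over the cells of a partition although `J = 1/Z` is not bounded ([LSW] define `M`
by continuity at `W = O`; this is the quantitative form of that continuity needed by the
conditional-increment proof of Lemma 8.9).
[cite: LawlerSchrammWerner2003Restriction, §8.4 (M_t at W_t = O_t) and proof of Lemma 8.9] -/
theorem norm_rho_deriv_sub_two_deriv_le (hc : JetControl E δ η R) (ρ : ℝ) {o : ℝ} (ho : o ∈ Ico (-R - 2) 0) :
    ‖(ρ : ℂ) * deriv (fun x ↦ ell E ρ x o) 0 - 2 * deriv (fun y ↦ ell E ρ 0 y) o‖ ≤ phiConst ρ δ η * |o| := by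
  have hη := hc.η_pos
  have hδ := hc.δ_pos
  have ho0 : o < 0 := ho.2
  have ho0' : (o : ℂ) ≠ 0 := by exact_mod_cast ho0.ne
  have hoB : (o : ℂ) ∈ jetBox R η := ofReal_mem_jetBox hc ⟨ho.1, ho.2.le.trans hη.le⟩
  have hPB := phiBound_nonneg ρ hδ hη
  have hFB : 0 ≤ phiFarBound ρ δ η := by unfold phiFarBound; positivity
  have habs : 0 < |o| := abs_pos.2 ho0.ne
  rcases le_or_gt (-(η / 8)) o with hnear | hfar
  · -- near the diagonal: the holomorphic function `φ`
    have hy : ‖(o : ℂ)‖ ≤ η / 8 := by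
      rw [Complex.norm_real, Real.norm_eq_abs, abs_of_neg ho0]; linarith
    rw [← phiFun_eq_of_ne hc ρ hoB ho0']
    calc ‖phiFun E ρ o‖ ≤ 8 * phiBound ρ δ η / η * ‖(o : ℂ)‖ := norm_phiFun_le_mul hc ρ hy
      _ = 8 * phiBound ρ δ η / η * |o| := by rw [Complex.norm_real, Real.norm_eq_abs]
      _ ≤ phiConst ρ δ η * |o| := by
          unfold phiConst; gcongr; linarith
  · -- away from the diagonal: crude bounds
    have h := norm_rho_deriv_sub_le_far hc ρ ⟨ho.1, ho0.le⟩ hfar.le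
    have hlow : 1 ≤ 8 / η * |o| := by
      rw [abs_of_neg ho0, div_mul_eq_mul_div, le_div_iff₀ hη]; linarith
    calc _ ≤ phiFarBound ρ δ η := h
      _ ≤ phiFarBound ρ δ η * (8 / η * |o|) := le_mul_of_one_le_right hFB hlow
      _ = 8 * phiFarBound ρ δ η / η * |o| := by ring
      _ ≤ phiConst ρ δ η * |o| := by
          unfold phiConst; gcongr; linarith

end Phi

end SLEKappaRho

end Literature.Probability.RandomPlanarGeometry

end
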